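import Summits.RiemannHypothesis.RiemannHypothesis.Theses.RobinStaircase
import HarnessLib

/-!
# `RobinStaircase.Assembly` (item stmt-RiemannHypothesis-22084) — glue closer

`KernelBase → Row15 → Row16 → Row17 → Row18 → StaircaseRange`: under the two print facts (Büthe 2018,
Broadbent et al. 2021) the target `StaircaseRange` is the conjunction of the kernel base and the four rows,
so the proof is the 5-tuple (same shape as the landed `RobinHighStaircase.assembly_proof`).
Cell rh-split (typer-3 g3 glue sweep, RULING #374).  Pure propositional glue; no analysis.
Nothing here bears on the truth of RH.
-/

set_option linter.dupNamespace false  -- the mandated namespace repeats `RiemannHypothesis`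

namespace Summit.RiemannHypothesis.RiemannHypothesis.Theorems.RobinStaircase

/-- **`Assembly` (item stmt-RiemannHypothesis-22084) holds**: the staircase range is the conjunction
of the kernel base and rows 15–18. [folklore] -/
theorem assembly_proof : Summit.RiemannHypothesis.RiemannHypothesis.Theses.RobinStaircase.Assembly :=
  fun h6 h5 h4 h3 h2 hB hK => ⟨h6 hB hK, h5 hB hK, h4 hB hK, h3 hB hK, h2 hB hK⟩

end Summit.RiemannHypothesis.RiemannHypothesis.Theorems.RobinStaircase
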